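import Summits.AtomisticToContinuum.BoseEinsteinCondensation.Theorems.BECCutLineWeakDisorderTwoReplicaTransienceBoundInsertionStepBounded
import Summits.AtomisticToContinuum.BoseEinsteinCondensation.Theorems.BECCutLineWeakDisorderTwoReplicaTransienceBoundSurvivalFloor
import Summits.AtomisticToContinuum.BoseEinsteinCondensation.Theorems.BECCutLineWeakDisorderTwoReplicaTransienceBoundRecursion
import Summits.AtomisticToContinuum.BoseEinsteinCondensation.Theorems.BECCutLineWeakDisorderTwoReplicaTransienceBoundSliceBound
import Literature.MathematicalPhysics.QuantumManyBody.BoseGasThermodynamicLimitRuelle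
import HarnessLib

/-!
# Crux `TwoReplicaTransienceBound` (stmt-AtomisticToContinuum-9687), line `SketchIdeator1` v6:
# the CHEMICAL-POTENTIAL WINDOW of the crux for bounded pair potentials (stub `stub_shortTimeBounded`)

Support file (`--supports stmt-AtomisticToContinuum-9687`, lead c3). For every BOUNDED admissible `v` there is `κ = κ(v) > 0`
(`κ = q₀²/(512 (‖v‖₁ + 1))`, `‖v‖₁ = ∫_{ℝ³} v(|y|)dy`) such that for EVERY density `ρ > 0`, eventually in `n`, for all
polymer lengths `0 ≤ T ≤ κ/ρ`:

`∫ L³ m_T(Y)²/s_T(Y)² dY ≤ 20`   (`Ψ_T = fkWitness v L T 1`, `L = sideLength ρ (n+1)`).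

The window `T ≲ 1/(ρ‖v‖₁)` is the chemical-potential (mean-field) time: beyond it inserting one line costs `e^{-μT}`,
`μ ≈ ρ‖v‖₁`, and the slice reduction `crux ≤ L³N_n/N_{n+1}` (`stub_sliceBound`) is no longer affordable. Same recursion as
`…ShortTime.lean` with the tangent insertion step `stub_insertionStepBounded` (error `(n+1)|Λ|·2T‖v‖₁·N_n`) in place of the
Wiener-sausage step: smallness `4A ≤ Θ²` ⇐ `512 n T ‖v‖₁ ρ ≤ q₀² (n+1)` ⇐ `Tρ ≤ κ`.
-/

noncomputable section

open MeasureTheory Filter Set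
open scoped ENNReal NNReal Topology BigOperators

namespace Summit.AtomisticToContinuum.BoseEinsteinCondensation.Cruxes.TwoReplicaTransienceBound.TracerDecoupling

open Literature.MathematicalPhysics.QuantumManyBody.BoseGas
open Summit.AtomisticToContinuum.BoseEinsteinCondensation.Theorems.CutLineWitness
open Summit.AtomisticToContinuum.BoseEinsteinCondensation.Cruxes.TwoReplicaTransienceBound.ShortTime

/-- **Registered toolbox stub `stub_shortTimeBounded`** (crux stmt-AtomisticToContinuum-9687, line `SketchIdeator1` v6): **the
crux on the chemical-potential window `0 ≤ T ≤ κ(v)/ρ`, for every bounded admissible `v`, EVERY density `ρ > 0`, eventually in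
`n`, with the absolute constant `20`** (tangent insertion step + recursion + survival floor + slice bound). -/
theorem stub_shortTimeBounded :
    ∀ (v : ℝ → ENNReal), IsRepulsiveFiniteRange v → (∃ C : NNReal, ∀ r, v r ≤ C) →
      ∃ κ : ℝ, 0 < κ ∧ ∀ ρ : ℝ, 0 < ρ → ∀ᶠ n : ℕ in Filter.atTop, ∀ T : ℝ, 0 ≤ T → T ≤ κ / ρ →
        ∫⁻ Y : Config n, ENNReal.ofReal (sideLength ρ (n + 1) ^ 3) *
            (∫⁻ x, (‖@fkWitness (n + 1) v (sideLength ρ (n + 1)) T (fun _ => (1 : ENNReal))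
              (Matrix.vecCons x Y)‖₊ : ENNReal) ^ 2) ^ 2 /
            (∫⁻ x, (‖@fkWitness (n + 1) v (sideLength ρ (n + 1)) T (fun _ => (1 : ENNReal))
              (Matrix.vecCons x Y)‖₊ : ENNReal)) ^ 2 ≤ ENNReal.ofReal 20 := by
  intro v hv hb
  obtain ⟨hvm, R₀, hR₀⟩ := hv
  obtain ⟨C, hC⟩ := hb
  -- the range, made nonnegative, and `‖v‖₁ < ∞`
  set R : ℝ := max R₀ 0 with hRdef
  have hvR : ∀ r, R < r → v r = 0 := fun r hr => hR₀ r (lt_of_le_of_lt (le_max_left _ _) hr)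
  set V₁ : ℝ≥0∞ := ∫⁻ y : Space, v ‖y‖ with hV₁def
  have hV₁le : V₁ ≤ (C : ℝ≥0∞) * volume (Metric.closedBall (0 : Space) R) := by
    calc V₁ ≤ ∫⁻ y : Space, (Metric.closedBall (0 : Space) R).indicator (fun _ => (C : ℝ≥0∞)) y := by
          refine lintegral_mono fun y => ?_
          by_cases hy : y ∈ Metric.closedBall (0 : Space) R
          · rw [Set.indicator_of_mem hy]; exact hC _
          · rw [Set.indicator_of_notMem hy]
            have hfar : R < ‖y‖ := by
              rw [Metric.mem_closedBall, dist_zero_right, not_le] at hy; exact hy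
            rw [hvR _ hfar]
      _ = (C : ℝ≥0∞) * volume (Metric.closedBall (0 : Space) R) :=
          lintegral_indicator_const Metric.isClosed_closedBall.measurableSet _
  have hV₁top : V₁ ≠ ⊤ :=
    ne_top_of_le_ne_top (ENNReal.mul_ne_top ENNReal.coe_ne_top measure_closedBall_lt_top.ne) hV₁le
  set V : ℝ := V₁.toReal with hVdef
  have hV : 0 ≤ V := ENNReal.toReal_nonneg
  have hVeq : V₁ = ENNReal.ofReal V := (ENNReal.ofReal_toReal hV₁top).symm
  set q₀ : ℝ := 1 - 6 * Real.exp (-5) with hq₀def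
  have hq₀ : 0 < q₀ := FreeGas.q0_pos
  refine ⟨q₀ ^ 2 / (512 * (V + 1)), by positivity, fun ρ hρ => ?_⟩
  set κ : ℝ := q₀ ^ 2 / (512 * (V + 1)) with hκdef
  have hκ : 0 < κ := by positivity
  -- eventually in `n`: the box is large, `L ≥ L₀ = √(1920 κ/ρ)`
  set L₀ : ℝ := Real.sqrt (1920 * (κ / ρ)) with hL₀def
  have hL₀ : 0 ≤ L₀ := Real.sqrt_nonneg _
  have hev : ∀ᶠ n : ℕ in Filter.atTop, L₀ ≤ sideLength ρ (n + 1) :=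
    ((tendsto_sideLength_atTop hρ).comp (tendsto_add_atTop_nat 1)).eventually_ge_atTop L₀
  filter_upwards [hev] with n hn T hT hTκ
  set L : ℝ := sideLength ρ (n + 1) with hLdef
  have hL : 0 < L := Real.rpow_pos_of_pos (div_pos (by exact_mod_cast Nat.succ_pos n) hρ) _
  have hL3 : L ^ 3 = ((n + 1 : ℕ) : ℝ) / ρ := sideLength_pow_three hρ (n + 1)
  -- the window condition `2T ≤ L²/960`
  have h2T : 2 * T ≤ L ^ 2 / 960 := by
    have h1 : L₀ ^ 2 ≤ L ^ 2 := pow_le_pow_left₀ hL₀ hn 2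
    rw [hL₀def, Real.sq_sqrt (by positivity)] at h1
    linarith
  /- ### the partition norms at this box and time -/
  set N : ℕ → ℝ≥0∞ := fun k => fkNormSq (N := k) v L T (fun _ => (1 : ℝ≥0∞)) with hNdef
  set Θ : ℝ≥0∞ := fkNormSq (N := 1) (fun _ => 0) L T (fun _ => (1 : ℝ≥0∞)) with hΘdef
  have hNtop : ∀ k, N k ≠ ⊤ := fun k =>
    Summit.AtomisticToContinuum.BoseEinsteinCondensation.Theorems.TwoReplicaTransienceBound.Negative.fkNormSq_one_ne_top
      (N := k) v L hT
  have hΘtop : Θ ≠ ⊤ :=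
    Summit.AtomisticToContinuum.BoseEinsteinCondensation.Theorems.TwoReplicaTransienceBound.Negative.fkNormSq_one_ne_top
      (N := 1) (fun _ => 0) L hT
  -- survival floor
  set θ₀ : ℝ≥0∞ := ENNReal.ofReal (q₀ * (L / 2) ^ 3) with hθ₀def
  have hθ₀Θ : θ₀ ≤ Θ := stub_survivalFloor L T hL hT h2T
  have hθ₀pos : θ₀ ≠ 0 := by
    rw [hθ₀def]; exact (ENNReal.ofReal_pos.2 (by positivity)).ne'
  have hθ₀top : θ₀ ≠ ⊤ := ENNReal.ofReal_ne_top
  -- the error coefficient `A = n · |Λ| · 2T‖v‖₁`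
  set A : ℝ≥0∞ := (n : ℝ≥0∞) * (ENNReal.ofReal (L ^ 3) * (ENNReal.ofReal (2 * T) * V₁)) with hAdef
  -- base of the recursion: `Θ N₀ ≤ N₁ = Θ`
  have hbase : Θ * N 0 ≤ N 1 := by
    calc Θ * N 0 ≤ Θ * 1 := mul_le_mul' le_rfl (fkNormSq_zero_particle_le v L T)
      _ = N 1 := by rw [mul_one, hNdef]; exact (fkNormSq_one_particle v L T).symm
  -- steps of the recursion (the tangent insertion step)
  have hsteps : ∀ k, k + 2 ≤ n + 1 → Θ * N (k + 1) ≤ N (k + 2) + A * N k := by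
    intro k hk
    have hins := stub_insertionStepBounded k v hvm L T hL hT
    refine hins.trans (add_le_add le_rfl (mul_le_mul' ?_ le_rfl))
    have hk' : ((k : ℝ≥0∞) + 1) ≤ (n : ℝ≥0∞) := by exact_mod_cast (by omega : k + 1 ≤ n)
    calc ((k : ℝ≥0∞) + 1) * ENNReal.ofReal (L ^ 3) * (ENNReal.ofReal (2 * T) * V₁)
        ≤ (n : ℝ≥0∞) * ENNReal.ofReal (L ^ 3) * (ENNReal.ofReal (2 * T) * V₁) :=
          mul_le_mul' (mul_le_mul' hk' le_rfl) le_rfl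
      _ = A := by rw [hAdef, mul_assoc]
  -- smallness `4A ≤ Θ²` from `T ≤ κ/ρ`, `κ = q₀²/(512 (‖v‖₁+1))`
  have hsmall : 4 * A ≤ Θ ^ 2 := by
    have hreal : 4 * ((n : ℝ) * (L ^ 3 * (2 * T * V))) ≤ (q₀ * (L / 2) ^ 3) ^ 2 := by
      -- `512 n T V ρ ≤ q₀² (n+1)`, using `L³ = (n+1)/ρ`
      have hn0 : (0 : ℝ) ≤ n := Nat.cast_nonneg n
      have h1 : T * ρ * (512 * (V + 1)) ≤ q₀ ^ 2 := by
        have := hTκ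
        rw [hκdef, le_div_iff₀ hρ, le_div_iff₀ (by positivity)] at this
        exact this
      have h2 : 512 * (n : ℝ) * T * V * ρ ≤ q₀ ^ 2 * ((n : ℝ) + 1) := by
        nlinarith [mul_nonneg hn0 hV, mul_nonneg hn0 hρ.le, sq_nonneg q₀, mul_nonneg (mul_nonneg hn0 hV) hρ.le,
          mul_nonneg (mul_nonneg (mul_nonneg hn0 hV) hρ.le) hT, mul_nonneg hn0 hT]
      have h3 : (q₀ * (L / 2) ^ 3) ^ 2 = q₀ ^ 2 * (L ^ 3) ^ 2 / 64 := by ring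
      rw [h3, hL3, Nat.cast_succ]
      rw [le_div_iff₀ (by norm_num : (0 : ℝ) < 64)]
      have hρne : ρ ≠ 0 := hρ.ne'
      field_simp
      nlinarith [h2, hn0, hV, hρ.le, hT]
    calc 4 * A = ENNReal.ofReal (4 * ((n : ℝ) * (L ^ 3 * (2 * T * V)))) := by
          rw [hAdef, hVeq, ENNReal.ofReal_mul (p := 4) (by norm_num), ENNReal.ofReal_ofNat,
            ENNReal.ofReal_mul (p := (n : ℝ)) (Nat.cast_nonneg n), ENNReal.ofReal_natCast,
            ENNReal.ofReal_mul (p := L ^ 3) (by positivity), ENNReal.ofReal_mul (p := 2 * T) (by linarith)]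
      _ ≤ ENNReal.ofReal ((q₀ * (L / 2) ^ 3) ^ 2) := ENNReal.ofReal_le_ofReal hreal
      _ = θ₀ ^ 2 := by rw [hθ₀def, ENNReal.ofReal_pow (by positivity)]
      _ ≤ Θ ^ 2 := pow_le_pow_left' hθ₀Θ 2
  -- the recursion
  have hrec : Θ * N n ≤ 2 * N (n + 1) := stub_recursion N Θ A (n + 1) hΘtop hNtop hbase hsteps hsmall n le_rfl
  /- ### the crux integral: normalisation bookkeeping and the slice reduction -/
  set 𝒩 : ℝ≥0∞ := fkNormSq (N := n + 1) v L T (fun _ => (1 : ℝ≥0∞)) with h𝒩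
  set c : ℝ := (Real.sqrt 𝒩.toReal)⁻¹ with hc
  have hΨ : ∀ X, fkWitness (N := n + 1) v L T (fun _ => (1 : ℝ≥0∞)) X = c * (fkPartition v L T X).toReal :=
    fun X => fkWitness_one_eq v L T X
  by_cases hc0 : c = 0
  · have h0 : ∀ X, fkWitness (N := n + 1) v L T (fun _ => (1 : ℝ≥0∞)) X = 0 := fun X => by
      rw [hΨ X, hc0, zero_mul]
    simp [h0]
  have hsqrt : Real.sqrt 𝒩.toReal ≠ 0 := fun h => hc0 (by rw [hc, h, inv_zero])
  have htR : 0 < 𝒩.toReal := not_le.1 fun h => hsqrt (Real.sqrt_eq_zero'.2 h)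
  have h𝒩0 : 𝒩 ≠ 0 := fun h => htR.ne' (by rw [h, ENNReal.toReal_zero])
  have h𝒩top : 𝒩 ≠ ⊤ := fun h => htR.ne' (by rw [h, ENNReal.toReal_top])
  have hc𝒩 : ENNReal.ofReal (c ^ 2) * 𝒩 = 1 := by
    have hc2 : c ^ 2 = (𝒩.toReal)⁻¹ := by rw [hc, inv_pow, Real.sq_sqrt htR.le]
    rw [hc2, ENNReal.ofReal_inv_of_pos htR, ENNReal.ofReal_toReal h𝒩top, ENNReal.inv_mul_cancel h𝒩0 h𝒩top]
  have hnn : ∀ X : Config (n + 1), (‖(fkPartition v L T X).toReal‖₊ : ℝ≥0∞) = fkPartition v L T X :=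
    fun X => coe_nnnorm_toReal (fkPartition_ne_top v L T X)
  simp_rw [hΨ]
  rw [lintegral_ratio_const_mul L (fun X => (fkPartition v L T X).toReal) hc0]
  simp_rw [hnn]
  -- `I ≤ c² · L³ · N_n`, and `Θ · (c² L³ N_n) ≤ c² L³ · 2 N_{n+1} = 2 L³`
  set I : ℝ≥0∞ := ENNReal.ofReal (c ^ 2) * ∫⁻ Y : Config n, ENNReal.ofReal (L ^ 3) *
      (∫⁻ x, fkPartition v L T (Matrix.vecCons x Y) ^ 2) ^ 2 /
        (∫⁻ x, fkPartition v L T (Matrix.vecCons x Y)) ^ 2 with hI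
  have hI1 : I ≤ ENNReal.ofReal (c ^ 2) * (ENNReal.ofReal (L ^ 3) * N n) :=
    mul_le_mul' le_rfl (lintegral_ratio_le hvm L T)
  have hI2 : Θ * I ≤ 2 * ENNReal.ofReal (L ^ 3) := by
    calc Θ * I ≤ Θ * (ENNReal.ofReal (c ^ 2) * (ENNReal.ofReal (L ^ 3) * N n)) := mul_le_mul' le_rfl hI1
      _ = ENNReal.ofReal (c ^ 2) * ENNReal.ofReal (L ^ 3) * (Θ * N n) := by ring
      _ ≤ ENNReal.ofReal (c ^ 2) * ENNReal.ofReal (L ^ 3) * (2 * N (n + 1)) := mul_le_mul' le_rfl hrec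
      _ = 2 * ENNReal.ofReal (L ^ 3) * (ENNReal.ofReal (c ^ 2) * 𝒩) := by rw [hNdef]; ring
      _ = 2 * ENNReal.ofReal (L ^ 3) := by rw [hc𝒩, mul_one]
  -- divide by the survival floor
  have hI3 : I ≤ 2 * ENNReal.ofReal (L ^ 3) / θ₀ := by
    rw [ENNReal.le_div_iff_mul_le (Or.inl hθ₀pos) (Or.inl hθ₀top)]
    calc I * θ₀ = θ₀ * I := mul_comm _ _
      _ ≤ Θ * I := mul_le_mul' hθ₀Θ le_rfl
      _ ≤ 2 * ENNReal.ofReal (L ^ 3) := hI2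
  refine hI3.trans ?_
  -- `2 L³ / (q₀ (L/2)³) = 16/q₀ ≤ 20`
  have hL3pos : 0 < L ^ 3 := by positivity
  rw [hθ₀def, ← ENNReal.ofReal_ofNat 2, ← ENNReal.ofReal_mul (by norm_num),
    ← ENNReal.ofReal_div_of_pos (by positivity)]
  refine ENNReal.ofReal_le_ofReal ?_
  rw [div_le_iff₀ (by positivity)]
  have h16 := sixteen_le_twenty_mul_q0
  nlinarith [hL3pos, h16, hq₀]


end Summit.AtomisticToContinuum.BoseEinsteinCondensation.Cruxes.TwoReplicaTransienceBound.TracerDecoupling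

end
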